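import Summits.QuantumFields.YangMills.Theses.DoublingDefect

/-!
# Birth skeleton (BC3) for crux `OneTorusExit` (stmt-QuantumFields-17753) — `Lines/birth.lean`

Registrar: `planner-skel-stmt-QuantumFields-17753-0` (skeleton-register one-shot; route
`route-QuantumFields-DoublingDefect`, sub-problem `YangMills`, re-audit bin HONEST), 2026-08-17.
It re-publishes, as the crux workfile `Lines/birth.lean`, the birth skeleton designed by the route
planner (`planner-plan-lens3-QuantumFields-resurrect-0`, evidence `OneTorusExit_birth_pub.lean`,
2026-08-17T02:11Z: "stub_Zt_pos + stub_free_energy_window ⇒ OneTorusExit by a real composition";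
route header TWO-LAYER PLAN: `OneTorusExit ⇐ ZtPositive → FreeEnergyWindow → OneTorusExit`).

Crux (route file `Theses/DoublingDefect.lean`, decl
`Summit.QuantumFields.YangMills.Theses.DoublingDefect.OneTorusExit`, rank 2, open problem): with
`Z_β(a,a,a,t)` Wilson's partition function of the faithful representation `r` on the anisotropic
four-torus `(ℤ/a)³ × (ℤ/t)` (inlined: product Haar probability, plaquettes via `finRotate`) and the
period-doubling (purity) defect `δ_β(L) := 1 − Z_β(L,L,L,2L)/Z_β(L,L,L,L)²` (`= 1 − Tr ρ_L²`,
`ρ_L = T_L^L / Tr T_L^L`, Lüscher's transfer matrix): for every simply-connected compact simple `G`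
and faithful unitary `r`, `∀ ε > 0, ∃ β₁, ∀ β ≥ β₁, ∀ L₀, ∃ L ≥ L₀, δ_β(L) ≤ ε`.

## The cut: positivity / one-scale free-energy window (the 2001 "(FE⁰) door")

* `stub_Zt_pos` — **the torus partition functions are positive reals**: `0 < Z_β(a,a,a,t)` for
  every `β`, `a`, `t` and every compact `G` carrying a faithful continuous unitary matrix
  representation `r` (no simplicity / simple-connectivity needed).  Content: the inlined `Z` is a
  Bochner integral, so positivity is NOT formal — it needs the integrand
  `U ↦ exp(−β S(U))` to be integrable for the product σ-algebra `MeasurableSpace.pi` of the Borel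
  σ-algebras: `G` is Hausdorff and second countable because `r.ρ` is a continuous injection of the
  compact `G` into `M_N(ℂ)`, hence `Pi.borelSpace`, the action is continuous (`r.continuous`,
  continuity of `mul`/`inv`/`Matrix.trace`/`re`), bounded on the compact configuration space, and
  `> 0` pointwise against a product of PROBABILITY measures (`haarMeasure_self`).  Without it the
  junk value `∫ = 0` would make `δ ≡ 1` and `Real.log` meaningless; it is load-bearing in the
  composition (logs are taken, `exp ∘ log = id` needs `Z > 0`).  Size M (Lean plumbing; the
  refuter's birth audit confirms the mathematics: "Bochner ∫ is the true partition function, Z>0").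
* `stub_free_energy_window` — **one-scale free-energy window at weak coupling (OPEN; load-bearing)**:
  for every simply-connected compact simple `G`, faithful `r` and `ε > 0` there is `β₁` such that
  for every `β ≥ β₁` there is ONE constant `f` (the bulk free-energy density at `β`; it is chosen
  BEFORE the scales, so it cannot absorb the defect) with, for every `L₀`, a scale `L ≥ L₀` at
  which BOTH torus free energies are `f·volume` up to `ε`:
  `|log Z_β(L⁴) + f L⁴| ≤ ε ∧ |log Z_β(L³×2L) + 2 f L⁴| ≤ ε`.
  Why plausibly true: in a massive (confined) phase `log Z_β(L³×t) = −t E₀(L) + log(1 + Σ_{i≥1}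
  e^{−t(E_i−E₀)})` with `E₀(L) − f L³ = O(e^{−c m L})` (Lüscher 1986) and the thermal sum `→ 0`
  for `t ≥ L → ∞` (glueballs `~ L³(m/L)^{3/2} e^{−mL}`, torelons `e^{−σ L t}`); at strong coupling
  it is a theorem of the Osterwalder–Seiler cluster expansion (winding polymers, `L⁴ e^{−cL}`).
  Why it might fail / teeth: it is the weak-coupling confinement scale seen once — `L ≳ ξ(β) ~
  e^{cβ}` is beyond every expansion (Bałaban's free-energy bounds on tori of side `≤ 4L` plus
  winding-sector isolation at the last scale is the intended door); for `U(1)₄` the photon gas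
  gives a universal shape-dependent constant (`log Z + f·vol → −γ(shape) ≠ 0`), so the stub is
  U(1)-FALSE exactly like the crux (barrier `AbelianDeconfinementD4` honoured: the proof must use
  the non-abelian group).  It is STRONGER than the crux in kind (it pins the bulk term to `o(1)`,
  not only the ratio), which is what makes it a free-energy statement attackable by RG free-energy
  bounds rather than a restatement of `δ ≤ ε`.  Size XL.
* `defect_le_of_logWindow`, `exit_of_pos_of_window` — the `sorry`-free real analysis:
  `log(Z₂/Z₁²) = (log Z₂ + 2c) − 2(log Z₁ + c) ≥ −3η`, `Z₂/Z₁² = exp(log(Z₂/Z₁²)) ≥ e^{−3η} ≥ 1 − 3η`,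
  run at `η = ε/3`.
* `OneTorusExit_of : <stub₁-sig> → <stub₂-sig> → OneTorusExit` — the registered composition (real
  proof, conclusion = the route decl BY NAME); `OneTorusExit_of_stubs : OneTorusExit` applies it to
  the two stubs by name (kernel check that the stub statements are literally its hypotheses).

Disproof used: none exists for this crux (`ledger crux ls stmt-QuantumFields-17753`: only the
refuter's `BirthAttack.lean`, verdict survives; its `oneTorusExit_trivial_without_L₀` mutation is
respected — both stubs keep the `∀ L₀, ∃ L ≥ L₀` guard where relevant, and `delta_zero`/`Z_zero_side`
(`a = 0`) are consistent with `stub_Zt_pos`).  Negatives index: no refuted statement of the summit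
concerns torus free energies / the purity defect.

BC3 probes (registrar folder `bc/probe_stub_Zt_pos.lean`, `bc/probe_stub_free_energy_window.lean`,
`bc/probe_stub_free_energy_window_aesop_nosimp.lean`; each imports ONLY the route file and restates
the REGISTERED (let-free) stub statement verbatim as the hypothesis; `set_option maxHeartbeats
400000`; one `example` per (target, tactic) because a heartbeat timeout inside `first | … | …` is
uncatchable and hides the later alternatives; farm `lean check`: rc 1 for every file, 18/18 examples
FAIL; the same battery on the let-form statements, `bc/v1_letform/`, fails 16/16 identically):
* `stub_Zt_pos → OneTorusExit` / `→ YangMills`: `exact?` "could not close the goal" (2/2);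
  `simpa`, `simpa [OneTorusExit]` / `simpa [YangMills]` deterministic timeout at `whnf` (4/4);
  `aesop` "failed to prove the goal after exhaustive search", unsolved `⊢ OneTorusExit` /
  `⊢ YangMills` (2/2).
* `stub_free_energy_window → OneTorusExit` / `→ YangMills`: `exact?` "could not close the goal"
  (2/2); `simpa`, `simpa [·]` timeout at `whnf` (4/4); `aesop` timeout at `whnf` (2/2) and, with its
  simp normalisation off (`aesop (config := { enableSimp := false })`), "failed to prove the goal
  after exhaustive search" (2/2).
No stub is cheaply the crux or the sub-problem statement.  (Semantically: stub 1 has no `β → ∞`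
content at all; stub 2 is log-additive with ONE bulk constant per `β` and reaches the ratio
`Z(L,2L)/Z(L,L)²` only through positivity + `exp ∘ log`, and it is not implied by the crux, whose
ratio is blind to the bulk term `E₀(L)·t − f·L³t`.)

REGISTERED FORM OF THE STATEMENTS.  The stub theorems (and the hypotheses of `OneTorusExit_of`) are
written LET-FREE — the crux's `let Z := …` / inner `let St/sh/pl := …` carriers fully inlined — so
that the one-line signatures recorded by `ledger skeleton check` are complete closed terms over tree
constants (the registrar's textual signature extractor stops at the first `:=`, which truncated the
let-form registration to `… let Z : ℝ → ℕ → ℕ → ℝ`).  `stub_Zt_pos_iff_carrier` /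
`stub_free_energy_window_iff_carrier` (`Iff.rfl`) certify in the kernel that the let-free statements
ARE the statements over the crux's verbatim carrier, which stay the human-readable form.

`lean check --json`: rc 0; sorries = 2 = stubs (`stub_Zt_pos`, `stub_free_energy_window`), zero
elsewhere.  Namespace `Summit.QuantumFields.YangMills.Cruxes.OneTorusExit.Birth`.
-/

noncomputable section

namespace Summit.QuantumFields.YangMills.Cruxes.OneTorusExit.Birth

open Summit.QuantumFields.YangMills.Theses.DoublingDefect

/-! ## The two registered stubs — the ONLY `sorry`s of this file (LET-FREE signatures: closed one-line terms
over tree constants, definitionally the carrier forms below) -/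

/-- **Stub 1 — positivity of the anisotropic-torus partition functions** (`0 < Z_β(a,a,a,t)`):
for every compact group `G` with a faithful continuous unitary matrix representation `r` (which
makes `G` Hausdorff and second countable, so the continuous, bounded, pointwise-positive Wilson
weight is integrable for the product σ-algebra against the product of Haar PROBABILITY measures).
Size M. -/
theorem stub_Zt_pos :
    ∀ (G : Type) [Group G] [TopologicalSpace G] [IsTopologicalGroup G] [CompactSpace G]
      [MeasurableSpace G] [BorelSpace G], ∀ r :
      Literature.MathematicalPhysics.QuantumFieldTheory.LatticeRep G, ∀ β : ℝ, ∀ a t : ℕ, 0 < ∫ U,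
      Real.exp (-β * ∑ x : Fin a × Fin a × Fin a × Fin t, ∑ q : {q : Fin 4 × Fin 4 // q.1 < q.2},
      ((r.N : ℝ) - (r.ρ (U (x, q.1.1) * U (![(finRotate a x.1, x.2.1, x.2.2.1, x.2.2.2), (x.1,
      finRotate a x.2.1, x.2.2.1, x.2.2.2), (x.1, x.2.1, finRotate a x.2.2.1, x.2.2.2), (x.1, x.2.1,
      x.2.2.1, finRotate t x.2.2.2)] q.1.1, q.1.2) * (U (![(finRotate a x.1, x.2.1, x.2.2.1,
      x.2.2.2), (x.1, finRotate a x.2.1, x.2.2.1, x.2.2.2), (x.1, x.2.1, finRotate a x.2.2.1,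
      x.2.2.2), (x.1, x.2.1, x.2.2.1, finRotate t x.2.2.2)] q.1.2, q.1.1))⁻¹ * (U (x,
      q.1.2))⁻¹)).trace.re)) ∂(MeasureTheory.Measure.pi fun _ : (Fin a × Fin a × Fin a × Fin t) ×
      Fin 4 => Literature.MathematicalPhysics.QuantumFieldTheory.haarProbability G) := by
  sorry

/-- **Stub 2 — one-scale free-energy window at weak coupling (OPEN; load-bearing).**  For every
simply-connected compact simple `G`, faithful `r`, `ε > 0`: `∃ β₁, ∀ β ≥ β₁, ∃ f` (ONE bulk
free-energy density, fixed before the scales) `∀ L₀, ∃ L ≥ L₀` with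
`|log Z_β(L⁴) + f L⁴| ≤ ε ∧ |log Z_β(L³×2L) + 2 f L⁴| ≤ ε` — both torus free energies equal
`f·volume` up to `ε` at one arbitrarily large scale (finite-size corrections `o(1)`: the massive /
confined signature; U(1)-false via the photon-gas Casimir constant).  Size XL. -/
theorem stub_free_energy_window :
    ∀ (G : Type) [Group G] [TopologicalSpace G] [IsTopologicalGroup G] [CompactSpace G]
      [MeasurableSpace G] [BorelSpace G],
      Literature.MathematicalPhysics.QuantumFieldTheory.IsCompactSimpleLieGroup G →
      SimplyConnectedSpace G → ∀ r : Literature.MathematicalPhysics.QuantumFieldTheory.LatticeRep G,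
      ∀ ε : ℝ, 0 < ε → ∃ β₁ : ℝ, ∀ β : ℝ, β₁ ≤ β → ∃ f : ℝ, ∀ L₀ : ℕ, ∃ L : ℕ, L₀ ≤ L ∧ |Real.log (∫
      U, Real.exp (-β * ∑ x : Fin L × Fin L × Fin L × Fin L, ∑ q : {q : Fin 4 × Fin 4 // q.1 < q.2},
      ((r.N : ℝ) - (r.ρ (U (x, q.1.1) * U (![(finRotate L x.1, x.2.1, x.2.2.1, x.2.2.2), (x.1,
      finRotate L x.2.1, x.2.2.1, x.2.2.2), (x.1, x.2.1, finRotate L x.2.2.1, x.2.2.2), (x.1, x.2.1,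
      x.2.2.1, finRotate L x.2.2.2)] q.1.1, q.1.2) * (U (![(finRotate L x.1, x.2.1, x.2.2.1,
      x.2.2.2), (x.1, finRotate L x.2.1, x.2.2.1, x.2.2.2), (x.1, x.2.1, finRotate L x.2.2.1,
      x.2.2.2), (x.1, x.2.1, x.2.2.1, finRotate L x.2.2.2)] q.1.2, q.1.1))⁻¹ * (U (x,
      q.1.2))⁻¹)).trace.re)) ∂(MeasureTheory.Measure.pi fun _ : (Fin L × Fin L × Fin L × Fin L) ×
      Fin 4 => Literature.MathematicalPhysics.QuantumFieldTheory.haarProbability G)) + f * (L : ℝ) ^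
      4| ≤ ε ∧ |Real.log (∫ U, Real.exp (-β * ∑ x : Fin L × Fin L × Fin L × Fin (2 * L), ∑ q : {q :
      Fin 4 × Fin 4 // q.1 < q.2}, ((r.N : ℝ) - (r.ρ (U (x, q.1.1) * U (![(finRotate L x.1, x.2.1,
      x.2.2.1, x.2.2.2), (x.1, finRotate L x.2.1, x.2.2.1, x.2.2.2), (x.1, x.2.1, finRotate L
      x.2.2.1, x.2.2.2), (x.1, x.2.1, x.2.2.1, finRotate (2 * L) x.2.2.2)] q.1.1, q.1.2) * (U
      (![(finRotate L x.1, x.2.1, x.2.2.1, x.2.2.2), (x.1, finRotate L x.2.1, x.2.2.1, x.2.2.2),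
      (x.1, x.2.1, finRotate L x.2.2.1, x.2.2.2), (x.1, x.2.1, x.2.2.1, finRotate (2 * L) x.2.2.2)]
      q.1.2, q.1.1))⁻¹ * (U (x, q.1.2))⁻¹)).trace.re)) ∂(MeasureTheory.Measure.pi fun _ : (Fin L ×
      Fin L × Fin L × Fin (2 * L)) × Fin 4 =>
      Literature.MathematicalPhysics.QuantumFieldTheory.haarProbability G)) + 2 * f * (L : ℝ) ^ 4| ≤
      ε := by
  sorry

/-! ## Carrier reading of the stubs (kernel-checked `Iff.rfl`: the registered let-free statements
ARE the statements over the crux's verbatim `let Z := …` carrier) -/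

/-- `stub_Zt_pos`, read over the crux's verbatim carrier `Z` (definitional unfolding only). -/
theorem stub_Zt_pos_iff_carrier :
    (∀ (G : Type) [Group G] [TopologicalSpace G] [IsTopologicalGroup G] [CompactSpace G]
      [MeasurableSpace G] [BorelSpace G], ∀ r :
      Literature.MathematicalPhysics.QuantumFieldTheory.LatticeRep G, ∀ β : ℝ, ∀ a t : ℕ, 0 < ∫ U,
      Real.exp (-β * ∑ x : Fin a × Fin a × Fin a × Fin t, ∑ q : {q : Fin 4 × Fin 4 // q.1 < q.2},
      ((r.N : ℝ) - (r.ρ (U (x, q.1.1) * U (![(finRotate a x.1, x.2.1, x.2.2.1, x.2.2.2), (x.1,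
      finRotate a x.2.1, x.2.2.1, x.2.2.2), (x.1, x.2.1, finRotate a x.2.2.1, x.2.2.2), (x.1, x.2.1,
      x.2.2.1, finRotate t x.2.2.2)] q.1.1, q.1.2) * (U (![(finRotate a x.1, x.2.1, x.2.2.1,
      x.2.2.2), (x.1, finRotate a x.2.1, x.2.2.1, x.2.2.2), (x.1, x.2.1, finRotate a x.2.2.1,
      x.2.2.2), (x.1, x.2.1, x.2.2.1, finRotate t x.2.2.2)] q.1.2, q.1.1))⁻¹ * (U (x,
      q.1.2))⁻¹)).trace.re)) ∂(MeasureTheory.Measure.pi fun _ : (Fin a × Fin a × Fin a × Fin t) ×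
      Fin 4 => Literature.MathematicalPhysics.QuantumFieldTheory.haarProbability G)) ↔
    ∀ (G : Type) [Group G] [TopologicalSpace G] [IsTopologicalGroup G] [CompactSpace G]
      [MeasurableSpace G] [BorelSpace G],
      ∀ r : Literature.MathematicalPhysics.QuantumFieldTheory.LatticeRep G,
      let Z : ℝ → ℕ → ℕ → ℝ := fun β a t =>
        let St := Fin a × Fin a × Fin a × Fin t
        let sh : St → Fin 4 → St := fun x μ => ![(finRotate a x.1, x.2.1, x.2.2.1, x.2.2.2),
          (x.1, finRotate a x.2.1, x.2.2.1, x.2.2.2), (x.1, x.2.1, finRotate a x.2.2.1, x.2.2.2),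
          (x.1, x.2.1, x.2.2.1, finRotate t x.2.2.2)] μ
        let pl : (St × Fin 4 → G) → St → Fin 4 → Fin 4 → G := fun U x μ ν =>
          U (x, μ) * U (sh x μ, ν) * (U (sh x ν, μ))⁻¹ * (U (x, ν))⁻¹
        ∫ U, Real.exp (-β * ∑ x : St, ∑ q : {q : Fin 4 × Fin 4 // q.1 < q.2},
          ((r.N : ℝ) - (r.ρ (pl U x q.1.1 q.1.2)).trace.re))
          ∂(MeasureTheory.Measure.pi fun _ : St × Fin 4 =>
            Literature.MathematicalPhysics.QuantumFieldTheory.haarProbability G)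
      ∀ β : ℝ, ∀ a t : ℕ, 0 < Z β a t :=
  Iff.rfl

/-- `stub_free_energy_window`, read over the crux's verbatim carrier `Z`. -/
theorem stub_free_energy_window_iff_carrier :
    (∀ (G : Type) [Group G] [TopologicalSpace G] [IsTopologicalGroup G] [CompactSpace G]
      [MeasurableSpace G] [BorelSpace G],
      Literature.MathematicalPhysics.QuantumFieldTheory.IsCompactSimpleLieGroup G →
      SimplyConnectedSpace G → ∀ r : Literature.MathematicalPhysics.QuantumFieldTheory.LatticeRep G,
      ∀ ε : ℝ, 0 < ε → ∃ β₁ : ℝ, ∀ β : ℝ, β₁ ≤ β → ∃ f : ℝ, ∀ L₀ : ℕ, ∃ L : ℕ, L₀ ≤ L ∧ |Real.log (∫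
      U, Real.exp (-β * ∑ x : Fin L × Fin L × Fin L × Fin L, ∑ q : {q : Fin 4 × Fin 4 // q.1 < q.2},
      ((r.N : ℝ) - (r.ρ (U (x, q.1.1) * U (![(finRotate L x.1, x.2.1, x.2.2.1, x.2.2.2), (x.1,
      finRotate L x.2.1, x.2.2.1, x.2.2.2), (x.1, x.2.1, finRotate L x.2.2.1, x.2.2.2), (x.1, x.2.1,
      x.2.2.1, finRotate L x.2.2.2)] q.1.1, q.1.2) * (U (![(finRotate L x.1, x.2.1, x.2.2.1,
      x.2.2.2), (x.1, finRotate L x.2.1, x.2.2.1, x.2.2.2), (x.1, x.2.1, finRotate L x.2.2.1,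
      x.2.2.2), (x.1, x.2.1, x.2.2.1, finRotate L x.2.2.2)] q.1.2, q.1.1))⁻¹ * (U (x,
      q.1.2))⁻¹)).trace.re)) ∂(MeasureTheory.Measure.pi fun _ : (Fin L × Fin L × Fin L × Fin L) ×
      Fin 4 => Literature.MathematicalPhysics.QuantumFieldTheory.haarProbability G)) + f * (L : ℝ) ^
      4| ≤ ε ∧ |Real.log (∫ U, Real.exp (-β * ∑ x : Fin L × Fin L × Fin L × Fin (2 * L), ∑ q : {q :
      Fin 4 × Fin 4 // q.1 < q.2}, ((r.N : ℝ) - (r.ρ (U (x, q.1.1) * U (![(finRotate L x.1, x.2.1,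
      x.2.2.1, x.2.2.2), (x.1, finRotate L x.2.1, x.2.2.1, x.2.2.2), (x.1, x.2.1, finRotate L
      x.2.2.1, x.2.2.2), (x.1, x.2.1, x.2.2.1, finRotate (2 * L) x.2.2.2)] q.1.1, q.1.2) * (U
      (![(finRotate L x.1, x.2.1, x.2.2.1, x.2.2.2), (x.1, finRotate L x.2.1, x.2.2.1, x.2.2.2),
      (x.1, x.2.1, finRotate L x.2.2.1, x.2.2.2), (x.1, x.2.1, x.2.2.1, finRotate (2 * L) x.2.2.2)]
      q.1.2, q.1.1))⁻¹ * (U (x, q.1.2))⁻¹)).trace.re)) ∂(MeasureTheory.Measure.pi fun _ : (Fin L ×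
      Fin L × Fin L × Fin (2 * L)) × Fin 4 =>
      Literature.MathematicalPhysics.QuantumFieldTheory.haarProbability G)) + 2 * f * (L : ℝ) ^ 4| ≤
      ε) ↔
    ∀ (G : Type) [Group G] [TopologicalSpace G] [IsTopologicalGroup G] [CompactSpace G]
      [MeasurableSpace G] [BorelSpace G],
      Literature.MathematicalPhysics.QuantumFieldTheory.IsCompactSimpleLieGroup G → SimplyConnectedSpace G →
      ∀ r : Literature.MathematicalPhysics.QuantumFieldTheory.LatticeRep G,
      let Z : ℝ → ℕ → ℕ → ℝ := fun β a t =>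
        let St := Fin a × Fin a × Fin a × Fin t
        let sh : St → Fin 4 → St := fun x μ => ![(finRotate a x.1, x.2.1, x.2.2.1, x.2.2.2),
          (x.1, finRotate a x.2.1, x.2.2.1, x.2.2.2), (x.1, x.2.1, finRotate a x.2.2.1, x.2.2.2),
          (x.1, x.2.1, x.2.2.1, finRotate t x.2.2.2)] μ
        let pl : (St × Fin 4 → G) → St → Fin 4 → Fin 4 → G := fun U x μ ν =>
          U (x, μ) * U (sh x μ, ν) * (U (sh x ν, μ))⁻¹ * (U (x, ν))⁻¹
        ∫ U, Real.exp (-β * ∑ x : St, ∑ q : {q : Fin 4 × Fin 4 // q.1 < q.2},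
          ((r.N : ℝ) - (r.ρ (pl U x q.1.1 q.1.2)).trace.re))
          ∂(MeasureTheory.Measure.pi fun _ : St × Fin 4 =>
            Literature.MathematicalPhysics.QuantumFieldTheory.haarProbability G)
      ∀ ε : ℝ, 0 < ε → ∃ β₁ : ℝ, ∀ β : ℝ, β₁ ≤ β → ∃ f : ℝ, ∀ L₀ : ℕ, ∃ L : ℕ, L₀ ≤ L ∧
        |Real.log (Z β L L) + f * (L : ℝ) ^ 4| ≤ ε ∧
          |Real.log (Z β L (2 * L)) + 2 * f * (L : ℝ) ^ 4| ≤ ε :=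
  Iff.rfl

/-! ## The composition (no `sorry` below this line) -/

/-- Pure real analysis: an `η`-window on the two free energies with a COMMON bulk constant `c`
forces the purity defect below `3η`:
`Z₂/Z₁² = exp((log Z₂ + 2c) − 2(log Z₁ + c)) ≥ exp(−3η) ≥ 1 − 3η`. -/
theorem defect_le_of_logWindow {Z₁ Z₂ c η : ℝ} (h₁ : 0 < Z₁) (h₂ : 0 < Z₂)
    (ha : |Real.log Z₁ + c| ≤ η) (hb : |Real.log Z₂ + 2 * c| ≤ η) :
    1 - Z₂ / Z₁ ^ 2 ≤ 3 * η := by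
  have hZ : 0 < Z₁ ^ 2 := by positivity
  have hlog : Real.log (Z₂ / Z₁ ^ 2) = Real.log Z₂ - 2 * Real.log Z₁ := by
    rw [Real.log_div h₂.ne' hZ.ne', Real.log_pow]
    push_cast
    ring
  have hlow : -(3 * η) ≤ Real.log (Z₂ / Z₁ ^ 2) := by
    rw [hlog]
    have ha' := (abs_le.mp ha).2
    have hb' := (abs_le.mp hb).1
    linarith
  have hexp : Real.exp (-(3 * η)) ≤ Z₂ / Z₁ ^ 2 := by
    calc Real.exp (-(3 * η)) ≤ Real.exp (Real.log (Z₂ / Z₁ ^ 2)) := Real.exp_le_exp.mpr hlow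
      _ = Z₂ / Z₁ ^ 2 := Real.exp_log (div_pos h₂ hZ)
  have hlin : -(3 * η) + 1 ≤ Real.exp (-(3 * η)) := Real.add_one_le_exp _
  linarith

/-- The composition over an ABSTRACT family `Z β a t`: positivity + the `ε/3`-window (with the bulk
constant chosen before the scales) ⇒ the exit `∀ ε > 0, ∃ β₁, ∀ β ≥ β₁, ∀ L₀, ∃ L ≥ L₀,
1 − Z β L (2L) / (Z β L L)² ≤ ε`. -/
theorem exit_of_pos_of_window (Z : ℝ → ℕ → ℕ → ℝ) (hpos : ∀ β : ℝ, ∀ a t : ℕ, 0 < Z β a t)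
    (hwin : ∀ ε : ℝ, 0 < ε → ∃ β₁ : ℝ, ∀ β : ℝ, β₁ ≤ β → ∃ f : ℝ, ∀ L₀ : ℕ, ∃ L : ℕ, L₀ ≤ L ∧
      |Real.log (Z β L L) + f * (L : ℝ) ^ 4| ≤ ε ∧
        |Real.log (Z β L (2 * L)) + 2 * f * (L : ℝ) ^ 4| ≤ ε) :
    ∀ ε : ℝ, 0 < ε → ∃ β₁ : ℝ, ∀ β : ℝ, β₁ ≤ β → ∀ L₀ : ℕ, ∃ L : ℕ, L₀ ≤ L ∧
      1 - Z β L (2 * L) / (Z β L L) ^ 2 ≤ ε := by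
  intro ε hε
  obtain ⟨β₁, hβ₁⟩ := hwin (ε / 3) (by positivity)
  refine ⟨β₁, fun β hβ L₀ => ?_⟩
  obtain ⟨f, hf⟩ := hβ₁ β hβ
  obtain ⟨L, hL, ha, hb⟩ := hf L₀
  refine ⟨L, hL, ?_⟩
  have hb' : |Real.log (Z β L (2 * L)) + 2 * (f * (L : ℝ) ^ 4)| ≤ ε / 3 := by
    simpa only [mul_assoc] using hb
  have h := defect_le_of_logWindow (hpos β L L) (hpos β L (2 * L)) ha hb'
  linarith

/-- **OneTorusExit_of** — the registered composition: stub₁-statement → stub₂-statement → the crux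
`Summit.QuantumFields.YangMills.Theses.DoublingDefect.OneTorusExit` BY NAME (real proof: instantiate
both stubs at `(G, r)`; the crux's `let Z`/`let δ` carriers are definitionally the abstract family of
`exit_of_pos_of_window`). -/
theorem OneTorusExit_of
    (hZ : ∀ (G : Type) [Group G] [TopologicalSpace G] [IsTopologicalGroup G] [CompactSpace G]
      [MeasurableSpace G] [BorelSpace G], ∀ r :
      Literature.MathematicalPhysics.QuantumFieldTheory.LatticeRep G, ∀ β : ℝ, ∀ a t : ℕ, 0 < ∫ U,
      Real.exp (-β * ∑ x : Fin a × Fin a × Fin a × Fin t, ∑ q : {q : Fin 4 × Fin 4 // q.1 < q.2},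
      ((r.N : ℝ) - (r.ρ (U (x, q.1.1) * U (![(finRotate a x.1, x.2.1, x.2.2.1, x.2.2.2), (x.1,
      finRotate a x.2.1, x.2.2.1, x.2.2.2), (x.1, x.2.1, finRotate a x.2.2.1, x.2.2.2), (x.1, x.2.1,
      x.2.2.1, finRotate t x.2.2.2)] q.1.1, q.1.2) * (U (![(finRotate a x.1, x.2.1, x.2.2.1,
      x.2.2.2), (x.1, finRotate a x.2.1, x.2.2.1, x.2.2.2), (x.1, x.2.1, finRotate a x.2.2.1,
      x.2.2.2), (x.1, x.2.1, x.2.2.1, finRotate t x.2.2.2)] q.1.2, q.1.1))⁻¹ * (U (x,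
      q.1.2))⁻¹)).trace.re)) ∂(MeasureTheory.Measure.pi fun _ : (Fin a × Fin a × Fin a × Fin t) ×
      Fin 4 => Literature.MathematicalPhysics.QuantumFieldTheory.haarProbability G))
    (hW : ∀ (G : Type) [Group G] [TopologicalSpace G] [IsTopologicalGroup G] [CompactSpace G]
      [MeasurableSpace G] [BorelSpace G],
      Literature.MathematicalPhysics.QuantumFieldTheory.IsCompactSimpleLieGroup G →
      SimplyConnectedSpace G → ∀ r : Literature.MathematicalPhysics.QuantumFieldTheory.LatticeRep G,
      ∀ ε : ℝ, 0 < ε → ∃ β₁ : ℝ, ∀ β : ℝ, β₁ ≤ β → ∃ f : ℝ, ∀ L₀ : ℕ, ∃ L : ℕ, L₀ ≤ L ∧ |Real.log (∫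
      U, Real.exp (-β * ∑ x : Fin L × Fin L × Fin L × Fin L, ∑ q : {q : Fin 4 × Fin 4 // q.1 < q.2},
      ((r.N : ℝ) - (r.ρ (U (x, q.1.1) * U (![(finRotate L x.1, x.2.1, x.2.2.1, x.2.2.2), (x.1,
      finRotate L x.2.1, x.2.2.1, x.2.2.2), (x.1, x.2.1, finRotate L x.2.2.1, x.2.2.2), (x.1, x.2.1,
      x.2.2.1, finRotate L x.2.2.2)] q.1.1, q.1.2) * (U (![(finRotate L x.1, x.2.1, x.2.2.1,
      x.2.2.2), (x.1, finRotate L x.2.1, x.2.2.1, x.2.2.2), (x.1, x.2.1, finRotate L x.2.2.1,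
      x.2.2.2), (x.1, x.2.1, x.2.2.1, finRotate L x.2.2.2)] q.1.2, q.1.1))⁻¹ * (U (x,
      q.1.2))⁻¹)).trace.re)) ∂(MeasureTheory.Measure.pi fun _ : (Fin L × Fin L × Fin L × Fin L) ×
      Fin 4 => Literature.MathematicalPhysics.QuantumFieldTheory.haarProbability G)) + f * (L : ℝ) ^
      4| ≤ ε ∧ |Real.log (∫ U, Real.exp (-β * ∑ x : Fin L × Fin L × Fin L × Fin (2 * L), ∑ q : {q :
      Fin 4 × Fin 4 // q.1 < q.2}, ((r.N : ℝ) - (r.ρ (U (x, q.1.1) * U (![(finRotate L x.1, x.2.1,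
      x.2.2.1, x.2.2.2), (x.1, finRotate L x.2.1, x.2.2.1, x.2.2.2), (x.1, x.2.1, finRotate L
      x.2.2.1, x.2.2.2), (x.1, x.2.1, x.2.2.1, finRotate (2 * L) x.2.2.2)] q.1.1, q.1.2) * (U
      (![(finRotate L x.1, x.2.1, x.2.2.1, x.2.2.2), (x.1, finRotate L x.2.1, x.2.2.1, x.2.2.2),
      (x.1, x.2.1, finRotate L x.2.2.1, x.2.2.2), (x.1, x.2.1, x.2.2.1, finRotate (2 * L) x.2.2.2)]
      q.1.2, q.1.1))⁻¹ * (U (x, q.1.2))⁻¹)).trace.re)) ∂(MeasureTheory.Measure.pi fun _ : (Fin L ×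
      Fin L × Fin L × Fin (2 * L)) × Fin 4 =>
      Literature.MathematicalPhysics.QuantumFieldTheory.haarProbability G)) + 2 * f * (L : ℝ) ^ 4| ≤
      ε) :
    Summit.QuantumFields.YangMills.Theses.DoublingDefect.OneTorusExit := by
  intro G _ _ _ _ _ _ hG hSC r Z δ ε hε
  have hpos : ∀ β : ℝ, ∀ a t : ℕ, 0 < Z β a t := fun β a t => hZ G r β a t
  have hwin : ∀ ε : ℝ, 0 < ε → ∃ β₁ : ℝ, ∀ β : ℝ, β₁ ≤ β → ∃ f : ℝ, ∀ L₀ : ℕ, ∃ L : ℕ, L₀ ≤ L ∧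
      |Real.log (Z β L L) + f * (L : ℝ) ^ 4| ≤ ε ∧
        |Real.log (Z β L (2 * L)) + 2 * f * (L : ℝ) ^ 4| ≤ ε := hW G hG hSC r
  exact exit_of_pos_of_window Z hpos hwin ε hε

/-- Kernel check that the two stub theorems are LITERALLY the hypotheses of `OneTorusExit_of`
(the crux from the stubs by name; `sorryAx` enters only through the two stubs). -/
theorem OneTorusExit_of_stubs : Summit.QuantumFields.YangMills.Theses.DoublingDefect.OneTorusExit :=
  OneTorusExit_of stub_Zt_pos stub_free_energy_window

/-- Signature match: the conclusion is the route decl. -/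
example : OneTorusExit := OneTorusExit_of_stubs

end Summit.QuantumFields.YangMills.Cruxes.OneTorusExit.Birth

end
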